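import Literature.AlgebraicGeometry.Resolution.LogRegularRefinementAbsorb
import HarnessLib

/-!
# Kato's dimension inequality `dim A ≤ rank P + d` and (10.3) under the inequality `≥`

`Literature/AlgebraicGeometry/Resolution/LogRegularDimensionBound.lean`. K. Kato, *Toric
singularities*, Amer. J. Math. 116 (1994), Lemma (2.3): for a local ring `A` with chart
`φ : P → A`, `dim A ≤ dim A/I(φ) + rank Pᵍᵖ` — so in Def. (2.1) log regularity is the
INEQUALITY `dim A ≥ dim A/I + rank`. We prove the d-form version from the structure surjection
`Λ⟦P⟧ ↠ Â` (`LogRegularCompleteStructure`): if `𝔪_A = (φ(P ∖ 0)) + (t₁,…,t_d)` then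
`dim A ≤ rank P + d`; consequently the regularity theorems of `LogRegularRefinementAbsorb.lean`
hold under the hypothesis `rank P + d ≤ dim A` (the form in which log regularity is inherited by
the base changes of the reduction to the closed point, where only lower bounds for the dimension
are elementary).

* `ringKrullDim_le_rank` — `𝔪_A = (φ(P ∖ 0))` ⇒ `dim A ≤ rank P`;
* `ringKrullDim_le_rank_add` — `𝔪_A = (φ(P ∖ 0)) + (t₁..t_d)` ⇒ `dim A ≤ rank P + d`;
* `isRegularLocalRing_localization_closedPoint_of_le` — Kato (10.3) at the closed point under
  `rank P + d ≤ dim A`.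

References: [Kato1994] K. Kato, Toric singularities, Amer. J. Math. 116 (1994), (2.1), (2.3), (3.2), (10.3).
-/

noncomputable section

open IsLocalRing MvPowerSeries Literature.RingTheory.MvPowerSeries
  Literature.RingTheory.MvPowerSeries.monoidPowerSeries
  Literature.RingTheory.CompleteLocalRings

namespace Literature.AlgebraicGeometry.Resolution

namespace LogRegularCompleteStructure

universe u

variable {A : Type u} [CommRing A] [IsLocalRing A] [IsNoetherianRing A] {M N d : ℕ}
  {P : AddSubmonoid (Fin M →₀ ℕ)} {φ : (Fin M →₀ ℕ) → A}

/-- **Kato's inequality (Lemma (2.3)), d = 0 form**: if the chart `φ : P → A` of a Noetherian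
local ring has `φ(P ∖ 0)` generating `𝔪_A`, then `dim A ≤ rank P` (via the surjection
`Λ⟦P⟧ ↠ Â` of the structure theorem: `dim Â ≤ dim Λ⟦P⟧/(θ) ≤ rank P`).
[cite: Kato1994, Lemma (2.3)] -/
theorem ringKrullDim_le_rank (hP : P.FG) (hφ0 : φ 0 = 1)
    (hφadd : ∀ a ∈ P, ∀ b ∈ P, φ (a + b) = φ a * φ b)
    (hφm : ∀ p ∈ P, p ≠ 0 → φ p ∈ maximalIdeal A)
    (hgen : maximalIdeal A ≤ Ideal.span (φ '' {p | p ∈ P ∧ p ≠ 0})) :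
    ringKrullDim A ≤ rank P := by
  classical
  haveI : IsNoetherianRing (AdicCompletion (maximalIdeal A) A) :=
    isNoetherianRing_adicCompletion_maximalIdeal A
  rw [← ringKrullDim_adicCompletion A]
  -- the chart of `Â`
  let φh : (Fin M →₀ ℕ) → AdicCompletion (maximalIdeal A) A := fun p => algebraMap A _ (φ p)
  have hφh0 : φh 0 = 1 := by simp only [φh, hφ0, map_one]
  have hφhadd : ∀ a ∈ P, ∀ b ∈ P, φh (a + b) = φh a * φh b := by
    intro a ha b hb; simp only [φh, hφadd a ha b hb, map_mul]
  have hφhm : ∀ p ∈ P, p ≠ 0 → φh p ∈ maximalIdeal (AdicCompletion (maximalIdeal A) A) := by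
    intro p hp hp0
    rw [AdicCompletion.maximalIdeal_eq_map]
    exact Ideal.mem_map_of_mem _ (hφm p hp hp0)
  have hgenh : maximalIdeal (AdicCompletion (maximalIdeal A) A) ≤
      Ideal.span (φh '' {p | p ∈ P ∧ p ≠ 0}) := by
    rw [AdicCompletion.maximalIdeal_eq_map]
    refine (Ideal.map_mono hgen).trans ?_
    rw [Ideal.map_span, ← Set.image_comp]
    rfl
  obtain ⟨p, hp⟩ := CharP.exists (ResidueField (AdicCompletion (maximalIdeal A) A))
  rcases CharP.char_is_prime_or_zero (ResidueField (AdicCompletion (maximalIdeal A) A)) p with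
    hprime | rfl
  · -- residue characteristic `p > 0`: `Â ≅ R⟦P⟧/K` with `θ ∈ K`, `θ ≠ 0`
    haveI : Fact p.Prime := ⟨hprime⟩
    obtain ⟨R, _, _, _, hRN, hRc, hmax, hp0, j, hres⟩ :=
      exists_cohenDVR_ringHom (AdicCompletion (maximalIdeal A) A) p
    haveI := hRN
    haveI := hRc
    have hpA : (p : AdicCompletion (maximalIdeal A) A) ∈
        maximalIdeal (AdicCompletion (maximalIdeal A) A) := by
      rw [← residue_eq_zero_iff, map_natCast]; exact CharP.cast_eq_zero _ p
    haveI : IsLocalHom j := by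
      refine ⟨fun r hr => ?_⟩
      by_contra hrn
      have hrm : r ∈ maximalIdeal R := (mem_maximalIdeal _).2 (mem_nonunits_iff.2 hrn)
      rw [hmax, Ideal.mem_span_singleton] at hrm
      obtain ⟨s, rfl⟩ := hrm
      rw [map_mul, map_natCast] at hr
      exact ((mem_maximalIdeal _).1 (Ideal.mul_mem_right _ _ hpA)) hr
    obtain ⟨ψ, hψsurj, hψmon, hψC⟩ := exists_lift_surjective j hres hP φh hφh0 hφhadd hφhm hgenh
    have hjp : j (p : R) ∈ maximalIdeal _ := by rw [map_natCast]; exact hpA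
    obtain ⟨θ, hθ, hθπ⟩ := exists_theta ψ hψsurj j hψC φh hψmon hgenh (p : R) hjp
    -- `Λ` is a DVR, `Λ⟦P⟧` a Noetherian local domain of dimension `≤ 1 + rank P`
    have hnf : ¬IsField R := by
      rw [IsLocalRing.isField_iff_maximalIdeal_eq, hmax, Ideal.span_singleton_eq_bot]; exact hp0
    have hprinc : (maximalIdeal R).IsPrincipal := ⟨⟨(p : R), hmax⟩⟩
    haveI : IsDiscreteValuationRing R := ((IsDiscreteValuationRing.TFAE R hnf).out 0 4).mpr hprinc
    haveI : IsDomain (MvPowerSeries (Fin M) R) := NoZeroDivisors.to_isDomain _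
    haveI : IsDomain (monoidPowerSeries R P) :=
      Function.Injective.isDomain (monoidPowerSeries R P).val.toRingHom Subtype.val_injective
    haveI : IsNoetherianRing (monoidPowerSeries R P) := monoidPowerSeries.isNoetherianRing hP
    haveI : IsLocalRing (monoidPowerSeries R P) := monoidPowerSeries.isLocalRing
    have hθ0 : θ ≠ 0 := by
      intro h; apply hp0; rw [← hθπ, h, Subalgebra.coe_zero, map_zero]
    have hdimD : ringKrullDim (monoidPowerSeries R P) ≤ 1 + (rank P : WithBot ℕ∞) := by
      have h := monoidPowerSeries.ringKrullDim_le (R := R) hP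
      rwa [IsDiscreteValuationRing.ringKrullDim_eq_one R] at h
    have hθK : Ideal.span {θ} ≤ RingHom.ker ψ := by
      rw [Ideal.span_le, Set.singleton_subset_iff]; exact hθ
    -- `dim Â = dim D/K ≤ dim D/(θ) ≤ dim D - 1 ≤ rank P`
    have e1 : ringKrullDim (monoidPowerSeries R P ⧸ RingHom.ker ψ) =
        ringKrullDim (AdicCompletion (maximalIdeal A) A) :=
      ringKrullDim_eq_of_ringEquiv (RingHom.quotientKerEquivOfSurjective hψsurj)
    have h1 : ringKrullDim (AdicCompletion (maximalIdeal A) A) ≤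
        ringKrullDim (monoidPowerSeries R P ⧸ Ideal.span {θ}) := by
      rw [← e1]
      exact ringKrullDim_le_of_surjective (Ideal.Quotient.factor hθK)
        (Ideal.Quotient.factor_surjective hθK)
    have h2 := Literature.RingTheory.KrullDimension.ringKrullDim_quotient_add_one_le
      (A := monoidPowerSeries R P) (𝔭 := Ideal.span {θ})
      (by rw [Ne, Ideal.span_singleton_eq_bot]; exact hθ0)
    -- arithmetic in `WithBot ℕ∞`
    obtain ⟨m, hm⟩ := exists_nat_cast_eq_ringKrullDim
      (R := AdicCompletion (maximalIdeal A) A)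
    haveI : IsLocalRing (monoidPowerSeries R P ⧸ Ideal.span {θ}) :=
      isLocalRing_quotient (by
        rw [Ne, Ideal.span_singleton_eq_top]
        intro hu
        have h := MvPowerSeries.isUnit_constantCoeff _ (hu.map (monoidPowerSeries R P).val)
        rw [show ((monoidPowerSeries R P).val θ) = (θ : MvPowerSeries (Fin M) R) from rfl, hθπ] at h
        exact ((mem_maximalIdeal _).1 (hmax ▸ Ideal.subset_span rfl : (p : R) ∈ maximalIdeal R)) h)
    obtain ⟨m', hm'⟩ := exists_nat_cast_eq_ringKrullDim (R := monoidPowerSeries R P ⧸ Ideal.span {θ})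
    rw [hm] at h1 ⊢
    rw [hm'] at h1 h2
    have h3 : ((m' + 1 : ℕ) : WithBot ℕ∞) ≤ 1 + (rank P : WithBot ℕ∞) := by
      push_cast; exact h2.trans hdimD
    have h4 : m ≤ m' := by exact_mod_cast h1
    have h5 : m' + 1 ≤ 1 + rank P := by exact_mod_cast h3
    exact_mod_cast (show m ≤ rank P by omega)
  · -- residue characteristic `0`: `Â ≅ K⟦P⟧/K'` and `dim K⟦P⟧ ≤ rank P`
    haveI : CharZero (ResidueField (AdicCompletion (maximalIdeal A) A)) := CharP.charP_to_charZero _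
    obtain ⟨σ, hσ⟩ := exists_coefficientField_of_charZero (AdicCompletion (maximalIdeal A) A)
    have hbot : maximalIdeal (ResidueField (AdicCompletion (maximalIdeal A) A)) = ⊥ :=
      (IsLocalRing.isField_iff_maximalIdeal_eq).1 (Field.toIsField _)
    haveI : IsAdicComplete (maximalIdeal (ResidueField (AdicCompletion (maximalIdeal A) A)))
        (ResidueField (AdicCompletion (maximalIdeal A) A)) := by rw [hbot]; infer_instance
    haveI : IsLocalHom σ := by
      refine ⟨fun x hx => ?_⟩
      by_contra hxn
      have hx0 : x = 0 := by by_contra h; exact hxn (Ne.isUnit h)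
      rw [hx0, map_zero] at hx
      exact not_isUnit_zero hx
    have hres : ∀ a : AdicCompletion (maximalIdeal A) A, ∃ l, a - σ l ∈ maximalIdeal _ :=
      fun a => ⟨residue _ a, by rw [← residue_eq_zero_iff, map_sub, hσ, sub_self]⟩
    obtain ⟨ψ, hψsurj, -, -⟩ := exists_lift_surjective σ hres hP φh hφh0 hφhadd hφhm hgenh
    haveI : IsNoetherianRing (monoidPowerSeries (ResidueField (AdicCompletion (maximalIdeal A) A)) P) :=
      monoidPowerSeries.isNoetherianRing hP
    haveI : IsLocalRing (monoidPowerSeries (ResidueField (AdicCompletion (maximalIdeal A) A)) P) :=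
      monoidPowerSeries.isLocalRing
    have hdimD : ringKrullDim (monoidPowerSeries (ResidueField (AdicCompletion (maximalIdeal A) A)) P) ≤
        (rank P : WithBot ℕ∞) := by
      have h := monoidPowerSeries.ringKrullDim_le (R := ResidueField (AdicCompletion (maximalIdeal A) A)) hP
      rwa [ringKrullDim_eq_zero_of_isField (Field.toIsField _), zero_add] at h
    exact (ringKrullDim_le_of_surjective ψ hψsurj).trans hdimD

/-- **Kato's inequality with `d` parameters**: if `𝔪_A = (φ(P ∖ 0)) + (t₁,…,t_d)` then
`dim A ≤ rank P + d`. [cite: Kato1994, Lemma (2.3)] -/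
theorem ringKrullDim_le_rank_add (hP : P.FG) (hφ0 : φ 0 = 1)
    (hφadd : ∀ a ∈ P, ∀ b ∈ P, φ (a + b) = φ a * φ b)
    (hφm : ∀ p ∈ P, p ≠ 0 → φ p ∈ maximalIdeal A) {t : Fin d → A} (ht : ∀ k, t k ∈ maximalIdeal A)
    (hgen : maximalIdeal A ≤ Ideal.span (φ '' {p | p ∈ P ∧ p ≠ 0}) ⊔ Ideal.span (Set.range t)) :
    ringKrullDim A ≤ (rank P + d : ℕ) := by
  rw [← rank_absorbMonoid P d]
  exact ringKrullDim_le_rank (absorbMonoid_fg hP) (absorbChart_zero hφ0 t) (absorbChart_add hφadd t)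
    (absorbChart_mem_maximalIdeal hφm ht) (maximalIdeal_le_span_absorbChart hφ0 hgen)

/-- **Kato 1994, (10.3) at the closed point, hypothesis in inequality form.** As
`isRegularLocalRing_localization_closedPoint_absorb`, with `dim A = rank P + d` weakened to
`rank P + d ≤ dim A` (equality then holds by `ringKrullDim_le_rank_add`). [cite: Kato1994, (10.3)] -/
theorem isRegularLocalRing_localization_closedPoint_of_le {c : (Fin M →₀ ℕ) → (Fin N →₀ ℕ)}
    {t : Fin d → A} (hP : P.FG)
    (hφ0 : φ 0 = 1) (hφadd : ∀ a ∈ P, ∀ b ∈ P, φ (a + b) = φ a * φ b)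
    (hφm : ∀ p ∈ P, p ≠ 0 → φ p ∈ maximalIdeal A) (ht : ∀ k, t k ∈ maximalIdeal A)
    (hgen : maximalIdeal A ≤ Ideal.span (φ '' {p | p ∈ P ∧ p ≠ 0}) ⊔ Ideal.span (Set.range t))
    (hdim : ((rank P + d : ℕ) : WithBot ℕ∞) ≤ ringKrullDim A)
    (hc0 : c 0 = 0) (hadd : ∀ a ∈ P, ∀ b ∈ P, c (a + b) = c a + c b)
    (hc : ∀ p ∈ P, p ≠ 0 → c p ≠ 0)
    (hfin : ∀ e : Fin N →₀ ℕ, {p : Fin M →₀ ℕ | p ∈ P ∧ c p = e}.Finite) :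
    letI := isMaximal_closedPoint (P := absorbMonoid P d) (absorbChart_zero hφ0 t)
      (absorbChart_mem_maximalIdeal hφm ht) (absorbMap_zero (d := d) hc0) (absorbMap_ne_zero hc)
    IsRegularLocalRing (Localization.AtPrime (closedPoint (absorbChart φ t) (absorbMap c)
        (absorbMonoid P d) (absorbChart_zero hφ0 t) (absorbChart_mem_maximalIdeal hφm ht)
        (absorbMap_zero (d := d) hc0) (absorbMap_ne_zero hc))) ∧
      ringKrullDim (Localization.AtPrime (closedPoint (absorbChart φ t) (absorbMap c)
        (absorbMonoid P d) (absorbChart_zero hφ0 t) (absorbChart_mem_maximalIdeal hφm ht)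
        (absorbMap_zero (d := d) hc0) (absorbMap_ne_zero hc))) = (N + d : ℕ) :=
  isRegularLocalRing_localization_closedPoint_absorb hP hφ0 hφadd hφm ht hgen
    (le_antisymm (ringKrullDim_le_rank_add hP hφ0 hφadd hφm ht hgen) hdim) hc0 hadd hc hfin

end LogRegularCompleteStructure

end Literature.AlgebraicGeometry.Resolution
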